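import Mathlib
import HarnessLib
import Summits.Ventures.LatticeQCDFlow.Scaling.U1IdentityFlowVolumeLaw
import Summits.Ventures.LatticeQCDFlow.Scaling.KLVolumeLawPi

/-!
# LatticeQCDFlow / Scaling — the untrained 2-d U(1) sampler, III: both Kullback–Leibler divergences
# in closed form, `D(Q‖P) = V·log I₀(β)` and `D(P‖Q) = V·(β I₁(β)/I₀(β) − log I₀(β))`

HONEST FRAMING: exact (Metropolis-corrected) sampling algorithms for lattice gauge theory;
figures of merit are autocorrelation/cost numbers at stated couplings and volumes; no
continuum-physics claim.

Venture `LatticeQCDFlow` (cell pub-lqcd), topic `Scaling`; FANOUT row 3 (`s0-u1-a`, S0-B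
implementation A: the 2-d U(1) flow sampler, GEN-12).  NEW WORK of the cell (closed forms, no
numerics), continuing `Scaling/U1IdentityFlowVolumeLaw` (imported: `V` independent plaquette
angles on `(0, 2π]`, Wilson density `p_β = e^{β cos θ}/Z(β)`, `Z(β) = 2π I₀(β)`, against the Haar
model `q = 1/(2π)`) with the general-space additivity of the divergences over independent blocks
(`Scaling/KLVolumeLawPi`, imported) and row 5's `∫₀^{2π} cos θ e^{β cos θ} dθ = 2π I₁(β)`
(`Scoring.integral_cos_mul_exp_mul_cos`):

* `log_u1Wilson_div_u1Haar` — `log(p_β/q) = β cos θ − log I₀(β)`;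
* **`u1_reverseKL_one`** — `D(q ‖ p_β) = ∫ q log(q/p_β) = log I₀(β)` (the model-side divergence of
  one plaquette: `E_q[cos θ] = 0`);
* **`u1_forwardKL_one`** — `D(p_β ‖ q) = ∫ p_β log(p_β/q) = β·I₁(β)/I₀(β) − log I₀(β)`
  (`E_{p_β}[cos θ] = I₁(β)/I₀(β)`, row 5's `onePlaquetteExpect_cos_eq_besselI_div` in integral form);
* **`u1IdentityFlow_reverseKL`**, **`u1IdentityFlow_forwardKL`** — for `V = card ι` independent
  plaquettes, `D(Q ‖ P) = V·log I₀(β)` and `D(P ‖ Q) = V·(β I₁(β)/I₀(β) − log I₀(β))` EXACTLY.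

Reading (value-free; no number of ours is computed or implied): for the factorised 2-d U(1) model
the identity flow's reverse KL — the quantity a reverse-KL-trained flow decreases from, equal to the
training loss plus `log Z = V log(2π I₀(β))` — is exactly `V·log I₀(β)`, linear in the volume and
`∼ V·(β − ½ log(2πβ))` at weak coupling, while its forward KL is `V·(β I₁/I₀ − log I₀)(β)`; with
`Scaling/U1IdentityFlowVolumeLaw` (`ESS_V = (I₀(β)²/I₀(2β))^V`) these are the closed-form
zero-training calibration constants of the S0-B training curves.  NOT CLAIMED: the periodic-torus
constraint; any value at the cell's `(β, L)`; nothing re-scored.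
-/

namespace Summit.Ventures.LatticeQCDFlow.Theory2

open MeasureTheory Real Set Finset
open Literature.Analysis.FunctionSpaces (besselI besselI_zero_pos)
open Summit.Ventures.LatticeQCDFlow.Scoring (onePlaquetteZ onePlaquetteZ_pos onePlaquetteZ_eq_besselI
  integral_cos_mul_exp_mul_cos)

/-! ## One plaquette -/

section OnePlaquette

/-- **`log(p_β/q) = β cos θ − log I₀(β)`** for the Wilson density against the Haar model. [ours] -/
theorem log_u1Wilson_div_u1Haar (β θ : ℝ) :
    Real.log (Real.exp (β * Real.cos θ) / onePlaquetteZ β / (1 / (2 * π)))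
      = β * Real.cos θ - Real.log (besselI 0 β) := by
  have hI : 0 < besselI 0 β := besselI_zero_pos β
  have e : Real.exp (β * Real.cos θ) / onePlaquetteZ β / (1 / (2 * π))
      = Real.exp (β * Real.cos θ) / besselI 0 β := by
    rw [onePlaquetteZ_eq_besselI]
    field_simp
  rw [e, Real.log_div (Real.exp_pos _).ne' hI.ne', Real.log_exp]

/-- The reverse log-ratio: `log(q/p_β) = log I₀(β) − β cos θ`. [ours] -/
theorem log_u1Haar_div_u1Wilson (β θ : ℝ) :
    Real.log ((1 / (2 * π)) / (Real.exp (β * Real.cos θ) / onePlaquetteZ β))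
      = Real.log (besselI 0 β) - β * Real.cos θ := by
  rw [← inv_div, Real.log_inv, log_u1Wilson_div_u1Haar]
  ring

/-- `∫_{(0,2π]} cos θ dθ = 0`. [folklore] -/
theorem integral_Ioc_cos : ∫ θ in Ioc (0 : ℝ) (2 * π), Real.cos θ = 0 := by
  rw [← intervalIntegral.integral_of_le (by positivity : (0 : ℝ) ≤ 2 * π), integral_cos,
    Real.sin_two_pi, Real.sin_zero, sub_zero]

/-- `∫_{(0,2π]} cos θ · e^{β cos θ}/Z(β) dθ = I₁(β)/I₀(β)` (`E_{p_β}[cos θ]`). [folklore] -/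
theorem integral_Ioc_cos_mul_u1Wilson (β : ℝ) :
    ∫ θ in Ioc (0 : ℝ) (2 * π), Real.cos θ * (Real.exp (β * Real.cos θ) / onePlaquetteZ β)
      = besselI 1 β / besselI 0 β := by
  have hI : 0 < besselI 0 β := besselI_zero_pos β
  have e : ∀ θ : ℝ, Real.cos θ * (Real.exp (β * Real.cos θ) / onePlaquetteZ β)
      = Real.cos θ * Real.exp (β * Real.cos θ) / onePlaquetteZ β := fun θ => by ring
  simp_rw [e]
  rw [integral_div, ← intervalIntegral.integral_of_le (by positivity : (0 : ℝ) ≤ 2 * π),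
    integral_cos_mul_exp_mul_cos, onePlaquetteZ_eq_besselI]
  field_simp

/-- `q log(q/p_β)` is integrable on `(0, 2π]`. [folklore] -/
theorem integrable_u1Haar_mul_log (β : ℝ) :
    Integrable (fun θ : ℝ => (1 / (2 * π)) *
        Real.log ((1 / (2 * π)) / (Real.exp (β * Real.cos θ) / onePlaquetteZ β)))
      (volume.restrict (Ioc (0 : ℝ) (2 * π))) := by
  simp_rw [log_u1Haar_div_u1Wilson]
  exact ((continuous_const.mul (continuous_const.sub
    (continuous_const.mul Real.continuous_cos))).integrableOn_Icc).mono_set Ioc_subset_Icc_self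

/-- `p_β log(p_β/q)` is integrable on `(0, 2π]`. [folklore] -/
theorem integrable_u1Wilson_mul_log (β : ℝ) :
    Integrable (fun θ : ℝ => Real.exp (β * Real.cos θ) / onePlaquetteZ β *
        Real.log (Real.exp (β * Real.cos θ) / onePlaquetteZ β / (1 / (2 * π))))
      (volume.restrict (Ioc (0 : ℝ) (2 * π))) := by
  simp_rw [log_u1Wilson_div_u1Haar]
  exact ((((Real.continuous_exp.comp (continuous_const.mul Real.continuous_cos)).div_const _).mul
    ((continuous_const.mul Real.continuous_cos).sub continuous_const)).integrableOn_Icc).mono_set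
    Ioc_subset_Icc_self

/-- **The one-plaquette REVERSE divergence**: `D(q ‖ p_β) = ∫ q log(q/p_β) = log I₀(β)`. [ours] -/
theorem u1_reverseKL_one (β : ℝ) :
    ∫ θ in Ioc (0 : ℝ) (2 * π), (1 / (2 * π)) *
        Real.log ((1 / (2 * π)) / (Real.exp (β * Real.cos θ) / onePlaquetteZ β))
      = Real.log (besselI 0 β) := by
  simp_rw [log_u1Haar_div_u1Wilson]
  have e : ∀ θ : ℝ, 1 / (2 * π) * (Real.log (besselI 0 β) - β * Real.cos θ)
      = Real.log (besselI 0 β) * (1 / (2 * π)) - β / (2 * π) * Real.cos θ := fun θ => by ring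
  simp_rw [e]
  have h1 : Integrable (fun _θ : ℝ => Real.log (besselI 0 β) * (1 / (2 * π)))
      (volume.restrict (Ioc (0 : ℝ) (2 * π))) := integrable_u1Haar.const_mul _
  have h2 : Integrable (fun θ : ℝ => β / (2 * π) * Real.cos θ)
      (volume.restrict (Ioc (0 : ℝ) (2 * π))) :=
    ((Real.continuous_cos.integrableOn_Icc).mono_set Ioc_subset_Icc_self).const_mul _
  rw [integral_sub h1 h2, integral_const_mul, integral_u1Haar, integral_const_mul, integral_Ioc_cos]
  ring

/-- **The one-plaquette FORWARD divergence**: `D(p_β ‖ q) = ∫ p_β log(p_β/q) = β I₁(β)/I₀(β) −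
log I₀(β)`. [ours] -/
theorem u1_forwardKL_one (β : ℝ) :
    ∫ θ in Ioc (0 : ℝ) (2 * π), Real.exp (β * Real.cos θ) / onePlaquetteZ β *
        Real.log (Real.exp (β * Real.cos θ) / onePlaquetteZ β / (1 / (2 * π)))
      = β * (besselI 1 β / besselI 0 β) - Real.log (besselI 0 β) := by
  simp_rw [log_u1Wilson_div_u1Haar]
  have e : ∀ θ : ℝ, Real.exp (β * Real.cos θ) / onePlaquetteZ β * (β * Real.cos θ - Real.log (besselI 0 β))
      = β * (Real.cos θ * (Real.exp (β * Real.cos θ) / onePlaquetteZ β))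
        - Real.log (besselI 0 β) * (Real.exp (β * Real.cos θ) / onePlaquetteZ β) := fun θ => by ring
  simp_rw [e]
  have h1 : Integrable (fun θ : ℝ => Real.cos θ * (Real.exp (β * Real.cos θ) / onePlaquetteZ β))
      (volume.restrict (Ioc (0 : ℝ) (2 * π))) :=
    ((Real.continuous_cos.mul ((Real.continuous_exp.comp (continuous_const.mul
      Real.continuous_cos)).div_const _)).integrableOn_Icc).mono_set Ioc_subset_Icc_self
  rw [integral_sub (h1.const_mul _) ((integrable_u1Wilson β).const_mul _), integral_const_mul,
    integral_const_mul, integral_Ioc_cos_mul_u1Wilson, integral_u1Wilson, mul_one]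

end OnePlaquette

/-! ## `V` independent plaquettes -/

section Plaquettes

variable {ι : Type*} [Fintype ι]

/-- **`D(Q ‖ P) = V·log I₀(β)`** — the reverse divergence (the flow's training objective net of
`log Z`) of the identity flow on `V = card ι` independent plaquettes, EXACTLY. [ours] -/
theorem u1IdentityFlow_reverseKL (β : ℝ) :
    ∫ x, (∏ _i : ι, (1 / (2 * π) : ℝ)) * Real.log ((∏ _i : ι, (1 / (2 * π) : ℝ))
        / ∏ i : ι, Real.exp (β * Real.cos (x i)) / onePlaquetteZ β)
        ∂(Measure.pi fun _ : ι => volume.restrict (Ioc (0 : ℝ) (2 * π)))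
      = Fintype.card ι * Real.log (besselI 0 β) := by
  rw [integral_mul_log_div_pi_const (ι := ι) (ν := volume.restrict (Ioc (0 : ℝ) (2 * π)))
    (p := fun _ => (1 / (2 * π) : ℝ)) (q := fun θ => Real.exp (β * Real.cos θ) / onePlaquetteZ β)
    (fun _ => by positivity) integrable_u1Haar integral_u1Haar (u1Wilson_pos β)
    (integrable_u1Haar_mul_log β), u1_reverseKL_one]

/-- **`D(P ‖ Q) = V·(β I₁(β)/I₀(β) − log I₀(β))`** — the forward divergence of the identity flow on
`V = card ι` independent plaquettes, EXACTLY. [ours] -/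
theorem u1IdentityFlow_forwardKL (β : ℝ) :
    ∫ x, (∏ i : ι, Real.exp (β * Real.cos (x i)) / onePlaquetteZ β)
        * Real.log ((∏ i : ι, Real.exp (β * Real.cos (x i)) / onePlaquetteZ β)
            / ∏ _i : ι, (1 / (2 * π) : ℝ))
        ∂(Measure.pi fun _ : ι => volume.restrict (Ioc (0 : ℝ) (2 * π)))
      = Fintype.card ι * (β * (besselI 1 β / besselI 0 β) - Real.log (besselI 0 β)) := by
  rw [integral_mul_log_div_pi_const (ι := ι) (ν := volume.restrict (Ioc (0 : ℝ) (2 * π)))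
    (p := fun θ => Real.exp (β * Real.cos θ) / onePlaquetteZ β) (q := fun _ => (1 / (2 * π) : ℝ))
    (u1Wilson_pos β) (integrable_u1Wilson β) (integral_u1Wilson β) (fun _ => by positivity)
    (integrable_u1Wilson_mul_log β), u1_forwardKL_one]

end Plaquettes

end Summit.Ventures.LatticeQCDFlow.Theory2
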